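import Summits.CriticalPhenomena.PercolationContinuityZ3.Theorems.PercLowPointHalfSpaceQuantitativeBGNFloorDefs
import Literature.Probability.Percolation.BondPercolationSymmetry
import Literature.Probability.Percolation.SiteConnectionTools
import Literature.Probability.Percolation.SharpnessDCTProofs
import HarnessLib

/-!
# `QuantitativeBGN` (stmt-CriticalPhenomena-0913), line `microscopic-floor-doubling-gain` — STUB 1 `stub_depthMono`

Crux `Summit.CriticalPhenomena.PercolationContinuityZ3.Theses.PercLowPointHalfSpace.QuantitativeBGN`
(item stmt-CriticalPhenomena-0913), line `microscopic-floor-doubling-gain`, stub `stub_depthMono`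
(STUB 1 of the line's skeleton `Cruxes/QuantitativeBGN/Lines/microscopic_floor_doubling_gain.lean`).

Statement proved: `∀ r h, gammaR r h ≤ gammaR r (h + 1)` — the depth-indexed boundary one-arm
probability `γ_r(h) = P_{p_c}(armFrom r h)` of
`Theorems/PercLowPointHalfSpaceQuantitativeBGNFloorDefs.lean` is non-decreasing in the depth `h` of
the floor `{x₀ = 0}` below the starting point `h·e₀`: starting one level deeper only helps.

Proof (vertical shift). The translation `ω ↦ ω + e₀` of configurations (`e₀ = Pi.single 0 1`,
`BondConfig.relabel (sym2Equiv (Site.shift e₀))`) preserves `P_{p_c}`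
(`bondPercolation_real_preimage_shift`, Grimmett 1999 §1.6), and
`armFrom r h ⊆ (ω ↦ ω + e₀) ⁻¹' armFrom r (h + 1)` (`FloorDepthMono.armFrom_subset_preimage_shift`):
an open `H`-path of `ω ∩ E(ℤ³)` from `h·e₀` to a point `y` at sup-distance `≥ r` from `h·e₀` is
carried by `x ↦ x + e₀` to an open `H`-path of `(ω + e₀) ∩ E(ℤ³)` from `(h+1)·e₀` to `y + e₀`
(`DCT16.pathIn_map`, `FloorDepthMono.adj_shift_iff`), at the same sup-distance from the new start.
Hence `γ_r(h) ≤ P_{p_c}((ω ↦ ω + e₀) ⁻¹' armFrom r (h+1)) = γ_r(h+1)` (`measureReal_mono`).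
-/

noncomputable section

namespace Summit.CriticalPhenomena.PercolationContinuityZ3.Theorems

open MeasureTheory Literature.Probability.Percolation Literature.Probability.LatticeModels
open FloorDoubling

namespace FloorDepthMono

/-- `h·e₀ + e₀ = (h+1)·e₀` in `ℤ³`. [folklore] -/
theorem start_add_single (h : ℕ) :
    (Pi.single 0 (h : ℤ) : Site 3) + Pi.single 0 1 = Pi.single 0 ((h + 1 : ℕ) : ℤ) := by
  rw [← Pi.single_add, Nat.cast_succ]

/-- The shift `x ↦ x + v` stays inside the half-space `H = {x | 0 ≤ x 0}` when `0 ≤ v 0`; here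
`v = e₀`. [folklore] -/
theorem add_single_mem_halfSpace {a : Site 3} (ha : a ∈ {x : Site 3 | 0 ≤ x 0}) :
    a + Pi.single 0 1 ∈ {x : Site 3 | 0 ≤ x 0} := by
  simp only [Set.mem_setOf_eq, Pi.add_apply, Pi.single_eq_same] at ha ⊢
  omega

/-- **Open lattice edges are shift-covariant.** `a + v ∼ b + v` is an open lattice edge of the
shifted configuration `ω + v` (read on `E(ℤ³)`) iff `a ∼ b` is an open lattice edge of `ω` (read on
`E(ℤ³)`): `mk_add_mem_relabel_shift_iff` for openness and `zdGraph_adj_shift_iff` for the lattice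
part. [folklore] -/
theorem adj_shift_iff (v : Site 3) (ω : BondConfig (Site 3)) (a b : Site 3) :
    (openGraph (BondConfig.relabel (sym2Equiv (Site.shift v)) ω ∩ (zdGraph 3).edgeSet)).Adj
        (a + v) (b + v) ↔
      (openGraph (ω ∩ (zdGraph 3).edgeSet)).Adj a b := by
  have hE : (zdGraph 3).Adj (a + v) (b + v) ↔ (zdGraph 3).Adj a b := zdGraph_adj_shift_iff v a b
  simp only [openGraph_adj, Set.mem_inter_iff, mk_add_mem_relabel_shift_iff, SimpleGraph.mem_edgeSet,
    hE, ne_eq, add_left_inj]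

/-- **The vertical shift carries `armFrom r h` into `armFrom r (h+1)`.** If `ω` has an open `H`-path
on `ω ∩ E(ℤ³)` from `h·e₀` to some `y` at sup-distance `≥ r` from `h·e₀`, then `ω + e₀` has an open
`H`-path on `(ω + e₀) ∩ E(ℤ³)` from `(h+1)·e₀` to `y + e₀`, at the same sup-distance from
`(h+1)·e₀` (transport of paths `DCT16.pathIn_map` along `x ↦ x + e₀`, which maps `H` into `H`).
[folklore] -/
theorem armFrom_subset_preimage_shift (r h : ℕ) :
    armFrom r h ⊆
      BondConfig.relabel (sym2Equiv (Site.shift (Pi.single 0 1 : Site 3))) ⁻¹' armFrom r (h + 1) := by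
  rintro ω ⟨y, ⟨i, hi⟩, hω⟩
  rw [Set.mem_preimage, mem_armFrom, ← start_add_single h]
  refine ⟨y + Pi.single 0 1, ⟨i, ?_⟩, ?_⟩
  · rwa [Pi.add_apply, Pi.add_apply, add_sub_add_right_eq_sub]
  · rw [DCT16.mem_openConnIn_iff_pathIn] at hω ⊢
    exact DCT16.pathIn_map (fun z => z + Pi.single 0 1) (B := {x : Site 3 | 0 ≤ x 0})
      (fun a ha => add_single_mem_halfSpace ha)
      (fun a b _ _ hab => (adj_shift_iff (Pi.single 0 1) ω a b).2 hab) hω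

end FloorDepthMono

open FloorDepthMono in
/-- **STUB 1 of line `microscopic-floor-doubling-gain` (`DepthMono`).** The depth-indexed boundary
one-arm probability at criticality is non-decreasing in the depth: `γ_r(h) ≤ γ_r(h+1)` for all
`r h`. The vertical shift `ω ↦ ω + e₀` preserves `P_{p_c}` (`bondPercolation_real_preimage_shift`)
and pulls `armFrom r (h+1)` back onto a superset of `armFrom r h`
(`FloorDepthMono.armFrom_subset_preimage_shift`), so `γ_r(h) ≤ P_{p_c}(pull-back) = γ_r(h+1)`.
[folklore] -/
theorem stub_depthMono : ∀ r h : ℕ, gammaR r h ≤ gammaR r (h + 1) := by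
  intro r h
  unfold gammaR
  rw [← bondPercolation_real_preimage_shift (Pi.single 0 1 : Site 3) (criticalProbI 3)
    (armFrom r (h + 1))]
  exact measureReal_mono (armFrom_subset_preimage_shift r h)

end Summit.CriticalPhenomena.PercolationContinuityZ3.Theorems

end
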